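import Literature.NumberTheory.Automorphic.EssConjSelfDual
import Literature.NumberTheory.GaloisRepresentations.AbsGaloisOuterConj
import Literature.NumberTheory.GaloisRepresentations.GaloisRep
import HarnessLib

/-!
# Clozel–Harris–Taylor 2008, Lemma 4.1.6 (with Lemma 4.1.3 (1)), specialised: over a CM field, a residually
# trivial algebraic character `θ` with `θ θ^c = ε_ℓ^k`, equal to `ε_ℓ^k` resp. `1` on the inertia groups of a
# CM type of places above `ℓ`

Topic `NumberTheory/GaloisRepresentations` (characters of absolute Galois groups of number fields; vocabulary
`absoluteGaloisGroup`, `absGaloisRestrict`, `absInertia`, `GaloisRep.cyclotomicCharacter` (`GaloisRep`), the outer action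
`absGaloisOuterConj F⁺ F c` and `absGaloisQuot` (`AbsGaloisOuterConj`), `NumberField.IsCMField`, `maximalRealSubfield`,
`IsCMField.complexConj` and its action on finite places (Mathlib CM fields, as used in `EssConjSelfDual`)).  Requested by the line
`thorne-minimal-lift` of crux `stmt-Langlands-13757` (blueprint fact F2′ of its stub `stub_pointAutomorphicT`: the twist taking the
polarization `ρ^c ≅ ρ^∨ ε^m` of a point of the ordinary family to Thorne's normalisation `ρ^c ≅ ρ^∨ ε^{1-n}`, with TRIVIAL residual twist
so that the residual image — hence Thorne-adequacy — is unchanged, and with explicit inertial restrictions above `ℓ` so that the twisted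
ordinary weight is explicit).

L. Clozel, M. Harris, R. Taylor, *Automorphy for some l-adic lifts of automorphic mod l Galois representations*, Publ. Math. IHÉS 108
(2008) (held text `paper:doi-10-1007-s10240-008-0016-1`, pp. 117–121, read 2026-08-17).  **Lemma 4.1.6** (pp. 120–121), as printed:

> Suppose that `l > 2` is a rational prime. Let `F` be an imaginary CM field with maximal totally real subfield `F⁺`. Let `S` be a
> finite set of finite places of `F` containing all primes above `l` and satisfying `S^c = S`. Let `χ : Gal(F̄/F⁺) → 𝒪_{ℚ̄_l}ˣ` and
> `θ̄ : Gal(F̄/F) → 𝔽̄_lˣ` be continuous characters with `θ̄ θ̄^c` equal to the reduction of `χ|_{Gal(F̄/F)}`. For `v ∈ S`, let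
> `ψ_v : Gal(F̄_v/F_v) → 𝒪_{ℚ̄_l}ˣ` be a continuous character lifting `θ̄|_{Gal(F̄_v/F_v)}` such that
> `(ψ_v ψ^c_{v^c})|_{I_{F_v}} = χ|_{I_{F_v}}`. Suppose also that if `τ : F ↪ ℚ̄_l` lies above `v ∈ S` then
> `dim gr^{m_τ}(ψ_v ⊗_{τ,F_v} B_dR)^{Gal(F̄_v/F_v)} = 1`, and that `m_τ + m_{τ∘c}` is independent of `τ`. Then there is a continuous
> character `θ : Gal(F̄/F) → 𝒪_{ℚ̄_l}ˣ` lifting `θ̄` and such that `θ θ^c = χ|_{Gal(F̄/F)}` and, for all `v ∈ S`,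
> `θ|_{I_{F_v}} = ψ_v|_{I_{F_v}}`. In particular `θ` is algebraic.

and Lemma 4.1.3 (pp. 117–118: every continuous algebraic character `ψ` of `Gal(F̄/F)` is `r_{l,ı}(χ)` for an algebraic Hecke character
`χ`, and "(1) For every prime `v ∤ l` of `F` we have `r_{l,ı}(χ)|_{Gal(F̄_v/F_v)} = χ_v ∘ Art⁻¹_{F_v}`" — so `ψ` is unramified at all but
finitely many places and has finite, hence potentially trivial, image on every inertia group away from `l`).

## What is vendored: the specialisation `χ = ε_l^k`, `θ̄ = 1`, `S = {v ∣ l}`, `ψ_v ∈ {ε_l^k, 1}` along a CM type of places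

NAMED FACT (D-0014) `ClozelHarrisTaylor2008.exists_cm_character_sq_eq_cyclotomic_pow`: for a CM number field `F`, a prime `ℓ > 2`, an
integer `k` such that the reduction of `ε_ℓ^k` is trivial on `Γ_F` (e.g. `ζ_ℓ ∈ F`), and a set `Φ` of places of `F` above `ℓ` containing
exactly one of `w, c·w` for every place `w ∣ ℓ` (so every place above `ℓ` is split over `F⁺`): there is a continuous character
`θ : Γ_F → ℚ̄_ℓˣ` which is residually trivial, satisfies `θ(θ_{c̃} σ) · θ(σ) = ε_ℓ(σ)^k` for every lift `c̃ ∈ Γ_{F⁺}` of complex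
conjugation (`θ θ^c = ε_ℓ^k`), equals `ε_ℓ^k` on the inertia group at every `w ∈ Φ` and `1` on the inertia group at every other place
above `ℓ`, is unramified at all but finitely many places, and is potentially unramified at every place not above `ℓ`.  This is Lemma
4.1.6 with `S :=` the places above `ℓ` (`S^c = S`), `χ := ε_ℓ^k|_{Γ_{F⁺}}`, `θ̄ := 1` (allowed by the hypothesis on the reduction of
`ε_ℓ^k`), `ψ_w := ε_ℓ^k|_{Γ_{F_w}}` for `w ∈ Φ` and `ψ_w := 1` for `w ∉ Φ` (these lift `1`; `(ψ_w ψ^c_{cw})|_{I_w} = ε_ℓ^k` in both cases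
since `ε_ℓ ∘ θ_{c̃} = ε_ℓ`; they are crystalline with `m_τ = -k` for `τ` above `Φ` and `m_τ = 0` above `Φ^c`, so `m_τ + m_{τ∘c} = -k` is
constant), followed by Lemma 4.1.3 (1) for the last two clauses.
-- TODO(general form): arbitrary `χ`, `θ̄`, `S` and local lifts `ψ_v` with the de Rham condition (p. 121 verbatim).

## References

* [ClozelHarrisTaylor2008] L. Clozel, M. Harris, R. Taylor, Publ. Math. IHÉS 108 (2008), Lemma 4.1.3 (pp. 117–118), Lemma 4.1.6
  (pp. 120–121).
-/

noncomputable section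

open scoped NumberField
open NumberField IsDedekindDomain Field Filter
open Literature.NumberTheory.GaloisRepresentations

namespace Literature.NumberTheory.GaloisRepresentations

namespace ClozelHarrisTaylor2008

/-- **CHT 2008, Lemma 4.1.6 (+ Lemma 4.1.3 (1)), specialised to `χ = ε_ℓ^k`, `θ̄ = 1`, local lifts `ε_ℓ^k` / `1` along a CM type of
places above `ℓ`**, NAMED FACT.  For every CM number field `F`, prime `ℓ > 2`, `k ∈ ℤ` with `ε_ℓ^k` residually trivial on `Γ_F`, and
`Φ` a set of places above `ℓ` meeting each pair `{w, c·w}` (`w ∣ ℓ`) in exactly one place: there is a continuous `θ : Γ_F → ℚ̄_ℓˣ`,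
residually trivial, with `θ(θ_{c̃} σ) θ(σ) = ε_ℓ(σ)^k` for every `c̃ ∈ Γ_{F⁺}` inducing complex conjugation on `F`, `θ = ε_ℓ^k` on `I_{F_w}`
for `w ∈ Φ`, `θ = 1` on `I_{F_w}` for the other `w ∣ ℓ`, unramified at almost all places and potentially unramified at every place not
above `ℓ`.  Printed lemma quoted in the module docstring.
[cite: ClozelHarrisTaylor2008, Lemma 4.1.6 (pp. 120–121) and Lemma 4.1.3 (1) (p. 118)] -/
def exists_cm_character_sq_eq_cyclotomic_pow : Prop :=
  ∀ (F : Type) [Field F] [NumberField F] [NumberField.IsCMField F] (ℓ : ℕ) [Fact ℓ.Prime], 2 < ℓ →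
    ∀ (k : ℤ),
      -- the reduction of `χ|_{Γ_F} = ε_ℓ^k` is trivial (so `θ̄ = 1` is admissible)
      (∀ σ : absoluteGaloisGroup F,
        PadicInt.toZMod (((GaloisRep.cyclotomicCharacter F ℓ σ) ^ k : ℤ_[ℓ]ˣ) : ℤ_[ℓ]) = 1) →
      -- a CM type `Φ` of places above `ℓ`
      ∀ (Φ : Finset (HeightOneSpectrum (𝓞 F))),
        (∀ w ∈ Φ, ((ℓ : ℕ) : 𝓞 F) ∈ w.asIdeal) →
        (∀ w : HeightOneSpectrum (𝓞 F), ((ℓ : ℕ) : 𝓞 F) ∈ w.asIdeal →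
          (w ∈ Φ ↔ NumberField.IsCMField.complexConj F • w ∉ Φ)) →
      ∃ θ : absoluteGaloisGroup F →ₜ* (PadicAlgCl ℓ)ˣ,
        -- `θ` lifts `θ̄ = 1`
        (∀ σ : absoluteGaloisGroup F, ‖((θ σ : (PadicAlgCl ℓ)ˣ) : PadicAlgCl ℓ) - 1‖ < 1) ∧
        -- `θ θ^c = ε_ℓ^k`
        (∀ c : absoluteGaloisGroup (maximalRealSubfield F),
          absGaloisQuot (maximalRealSubfield F) F c = IsCMField.complexConj F →
          ∀ σ : absoluteGaloisGroup F,
            ((θ (absGaloisOuterConj (maximalRealSubfield F) F c σ) : (PadicAlgCl ℓ)ˣ) : PadicAlgCl ℓ) *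
                (θ σ : PadicAlgCl ℓ) =
              algebraMap ℤ_[ℓ] (PadicAlgCl ℓ) (((GaloisRep.cyclotomicCharacter F ℓ σ) ^ k : ℤ_[ℓ]ˣ) : ℤ_[ℓ])) ∧
        -- `θ|_{I_{F_w}} = ε_ℓ^k|_{I_{F_w}}` for `w ∈ Φ`
        (∀ w ∈ Φ, ∀ τ ∈ absInertia (w.adicCompletion F),
          ((θ (absGaloisRestrict F (w.adicCompletion F) τ) : (PadicAlgCl ℓ)ˣ) : PadicAlgCl ℓ) =
            algebraMap ℤ_[ℓ] (PadicAlgCl ℓ)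
              (((GaloisRep.cyclotomicCharacter (w.adicCompletion F) ℓ τ) ^ k : ℤ_[ℓ]ˣ) : ℤ_[ℓ])) ∧
        -- `θ|_{I_{F_w}} = 1` for the other places above `ℓ`
        (∀ w : HeightOneSpectrum (𝓞 F), ((ℓ : ℕ) : 𝓞 F) ∈ w.asIdeal → w ∉ Φ →
          ∀ τ ∈ absInertia (w.adicCompletion F), θ (absGaloisRestrict F (w.adicCompletion F) τ) = 1) ∧
        -- algebraic ⇒ unramified almost everywhere …
        (∀ᶠ v : HeightOneSpectrum (𝓞 F) in cofinite,
          ∀ τ ∈ absInertia (v.adicCompletion F), θ (absGaloisRestrict F (v.adicCompletion F) τ) = 1) ∧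
        -- … and potentially unramified at every place not above `ℓ`
        (∀ v : HeightOneSpectrum (𝓞 F), ((ℓ : ℕ) : 𝓞 F) ∉ v.asIdeal →
          ∃ U : OpenSubgroup (absoluteGaloisGroup (v.adicCompletion F)),
            ∀ τ ∈ absInertia (v.adicCompletion F), τ ∈ U → θ (absGaloisRestrict F (v.adicCompletion F) τ) = 1)

end ClozelHarrisTaylor2008

end Literature.NumberTheory.GaloisRepresentations

end
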